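import Mathlib
import HarnessLib
import Summits.Ventures.LatticeQCDFlow.Exactness.NCMCGeneralSpaceEstimatorCLT

/-!
# Asymptotic normality of the reported Kish fraction on a general state space (two-dimensional delta method without a two-dimensional CLT)

HONEST FRAMING: exact (Metropolis-corrected) sampling algorithms for lattice gauge theory;
figures of merit are autocorrelation/cost numbers at stated couplings and volumes; no
continuum-physics claim.

Venture `LatticeQCDFlow` (cell pub-lqcd), topic `Exactness`; FANOUT row 13 (`eng-snf`, GEN-13).
NEW WORK of the cell (elementary asymptotic statistics on product laws, from Mathlib's central
limit theorem, Slutsky's theorem and the strong law), not a published result; nothing is cited as a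
fact (the "delta method" and A. Kong's `ESS = n/(1 + cv²)` reading, U. Chicago Tech. Rep. 348
(1992), named only).  Continuation of `NCMCGeneralSpaceEstimatorCLT.lean` (GEN-12), whose NOT-TYPED
list carried "the 2-dimensional delta method (hence no CLT for `essHat`)".  Vocabulary reused:
`sampleMean` (`JarzynskiEstimatorBias.lean`), `essHat` (`SampleESS.lean`), `fwdPathLaw`, `CrooksPair`.

## Setting and content

`μ` a probability law on records `E`; the run `ω : ℕ → E` carries `Measure.infinitePi (fun _ => μ)`;
for a weight `w`: `Ȳ_n = (1/n) Σ_{i<n} w(ω i)`, `S̄_n = (1/n) Σ_{i<n} w(ω i)²`, `θ = E_μ w`,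
`σ = E_μ w²`; the reported Kish fraction is `essHat (w(ω i))_{i<n} = Ȳ_n²/S̄_n`, with population value
`θ²/σ` (`NCMCGeneralSpaceEstimatorConsistency.tendsto_essHat_ae`).  A function of TWO sample means
calls for a joint CLT, which Mathlib does not have; this file avoids it by an EXACT split: with the
score `sc = 2θσ·w − θ²·w²` (mean `θ²σ`) and its sample mean `S̄c_n`, for `n ≥ 1`
`√n (essHat_n − θ²/σ) = (√n (S̄c_n − θ²σ) + σ · √n (Ȳ_n − θ)²) · S̄_n⁻¹ · σ⁻¹`
(`sqrt_mul_essHat_sub_eq`); the first summand obeys the ONE-dimensional CLT, the quadratic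
remainder has mean `Var_μ[w]/√n → 0` (so `→ 0` in `L¹` and in probability), `S̄_n⁻¹ → σ⁻¹` a.s.;
two Slutsky steps finish.

* `integral_sampleMean_run`, `memLp_sampleMean_run`, **`variance_sampleMean_run`**
  (`Var[Ȳ_n] = Var_μ[w]/n` under `Measure.infinitePi`), **`integral_sqrt_mul_sq_sampleMean_sub`**
  (`E[√n (Ȳ_n − θ)²] = Var_μ[w]/√n`), **`tendstoInMeasure_sqrt_mul_sq_sampleMean_sub`** (the
  quadratic remainder of ANY delta method on an i.i.d. run `→ 0` in probability — reusable);
  `sqrt_mul_essHat_sub_eq` (the split);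
* **`tendstoInDistribution_sqrt_mul_essHat_sub`** — THE CLT FOR THE KISH FRACTION: for a positive
  measurable weight with `w² ∈ L²(μ)`, `√n (essHat_n − θ²/σ) →d N(0, Var_μ[2θσ·w − θ²·w²]/σ⁴)`.
* For a Crooks pair `(κF, κR, s, e, W)` from `ν₀` to `ν₁` with `e^{−2W} ∈ L²(P_F)` (`E_F e^{−4W} < ∞`),
  along independent forward evolutions from prior equilibrium:
  **`CrooksPair.tendstoInDistribution_essHat`** — `√n (essHat (e^{−W_i})_{i<n} − ESS_F) →d
  N(0, Var_F[2θσ e^{−W} − θ² e^{−2W}]/σ⁴)`, `θ = Z₁/Z₀ = e^{−ΔF}`, `σ = E_F e^{−2W}`, `ESS_F = θ²/σ`;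
  `CrooksPair.essHat_asymptoticVariance_eq` / **`CrooksPair.tendstoInDistribution_essHat_dissipation`**
  — the same with the variance written `ESS_F² · Var_F[2e^{−W_d} − ESS_F·e^{−2W_d}]`, `W_d = W − ΔF`,
  `ESS_F = 1/E_F e^{−2W_d}` (`NCMCGeneralSpaceDissipation.essPop_eq_inv_dissipation`).
  Reading for the engine (`snf.estimators.ess`): the boarded Kish fraction of `N` independent
  evolutions fluctuates at scale `N^{−1/2}` around `ESS_F` with a variance set by the first FOUR
  exponential moments of the dissipated work — a strictly stronger demand (`E_F e^{−4W} < ∞`) than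
  the `E_F e^{−2W} < ∞` under which `ess` itself converges.

Scope / NOT CLAIMED: independent evolutions only (no correlated chain starts, no block estimates);
no value for any concrete protocol; limits in distribution, not finite-`N` coverage; nothing about
the regime `E_F e^{−4W} = ∞`.
-/

namespace Summit.Ventures.LatticeQCDFlow.Exactness.GeneralNCMC

open MeasureTheory ProbabilityTheory Set Filter Finset
open scoped ENNReal NNReal Topology

variable {E : Type*} [MeasurableSpace E]

section IID

variable (μ : Measure E) [IsProbabilityMeasure μ]
variable {Ω' : Type*} [MeasurableSpace Ω'] {P' : Measure Ω'} [IsProbabilityMeasure P']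

/-! ## Mean and variance of a sample mean of an infinite i.i.d. run -/

/-- `E[Ȳ_n] = E_μ g` for `n ≥ 1`. -/
theorem integral_sampleMean_run {g : E → ℝ} (hg : Measurable g) (hgi : Integrable g μ) {n : ℕ}
    (hn : 0 < n) :
    ∫ ω, sampleMean g (fun i : Fin n => ω i) ∂(Measure.infinitePi fun _ : ℕ => μ) = ∫ a, g a ∂μ := by
  unfold sampleMean
  have hint : ∀ i : Fin n, Integrable (fun ω : ℕ → E => g (ω i)) (Measure.infinitePi fun _ : ℕ => μ) :=
    fun i => (measurePreserving_eval_infinitePi (fun _ : ℕ => μ) (i : ℕ)).integrable_comp_of_integrable hgi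
  rw [integral_div, integral_finsetSum _ fun i _ => hint i]
  have hterm : ∀ i : Fin n, ∫ ω, g (ω i) ∂(Measure.infinitePi fun _ : ℕ => μ) = ∫ a, g a ∂μ :=
    fun i => integral_comp_eval_infinitePi μ hg.aestronglyMeasurable (i : ℕ)
  simp_rw [hterm]
  rw [Finset.sum_const, card_univ, Fintype.card_fin, nsmul_eq_mul]
  have hn' : (n : ℝ) ≠ 0 := by exact_mod_cast hn.ne'
  field_simp

/-- The sample mean of an `L²` observable is in `L²` of the run. -/
theorem memLp_sampleMean_run {g : E → ℝ} (hg : Measurable g) (hL2 : MemLp g 2 μ) (n : ℕ) :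
    MemLp (fun ω : ℕ → E => sampleMean g (fun i : Fin n => ω i)) 2
      (Measure.infinitePi fun _ : ℕ => μ) := by
  have hfun : (fun ω : ℕ → E => sampleMean g (fun i : Fin n => ω i)) =
      fun ω => (n : ℝ)⁻¹ * ∑ i : Fin n, g (ω i) := by
    funext ω
    unfold sampleMean
    rw [div_eq_inv_mul]
  rw [hfun]
  refine MemLp.const_mul ?_ _
  refine memLp_finsetSum _ fun i _ => ?_
  exact (identDistrib_comp_eval_infinitePi_self μ hg (i : ℕ)).memLp_iff.2 hL2

/-- **`Var[Ȳ_n] = Var_μ[g] / n`** along an infinite i.i.d. run (`n ≥ 1`, `g ∈ L²(μ)`; pairwise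
independence of the coordinates, Mathlib's `IndepFun.variance_sum`). -/
theorem variance_sampleMean_run {g : E → ℝ} (hg : Measurable g) (hL2 : MemLp g 2 μ) {n : ℕ}
    (hn : 0 < n) :
    Var[fun ω : ℕ → E => sampleMean g (fun i : Fin n => ω i); Measure.infinitePi fun _ : ℕ => μ] =
      Var[g; μ] / n := by
  have hfun : (fun ω : ℕ → E => sampleMean g (fun i : Fin n => ω i)) =
      fun ω => (n : ℝ)⁻¹ * (∑ i : Fin n, fun ω : ℕ → E => g (ω i)) ω := by
    funext ω
    unfold sampleMean
    rw [Finset.sum_apply, div_eq_inv_mul]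
  have hn' : (n : ℝ) ≠ 0 := by exact_mod_cast hn.ne'
  rw [hfun, variance_const_mul, IndepFun.variance_sum (fun i _ => ?_) (fun i _ j _ hij => ?_)]
  · have hterm : ∀ i : Fin n,
        Var[fun ω : ℕ → E => g (ω i); Measure.infinitePi fun _ : ℕ => μ] = Var[g; μ] :=
      fun i => variance_comp_eval_infinitePi μ hg (i : ℕ)
    simp_rw [hterm]
    rw [Finset.sum_const, card_univ, Fintype.card_fin, nsmul_eq_mul]
    field_simp
  · exact (identDistrib_comp_eval_infinitePi_self μ hg (i : ℕ)).memLp_iff.2 hL2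
  · exact pairwise_indepFun_comp_eval_infinitePi μ hg (Fin.val_injective.ne hij)

/-! ## The quadratic remainder of a delta method vanishes in probability -/

/-- The quadratic remainder is a measurable function of the run. -/
theorem measurable_sqrt_mul_sq_sampleMean_sub {g : E → ℝ} (hg : Measurable g) (θ : ℝ) (n : ℕ) :
    Measurable fun ω : ℕ → E => √(n : ℝ) * (sampleMean g (fun i : Fin n => ω i) - θ) ^ 2 :=
  (((measurable_sampleMean_run hg n).sub measurable_const).pow_const 2).const_mul _

/-- **`E[√n (Ȳ_n − θ)²] = Var_μ[g] / √n`** (`n ≥ 1`, `g ∈ L²(μ)`, `θ = E_μ g`). -/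
theorem integral_sqrt_mul_sq_sampleMean_sub {g : E → ℝ} (hg : Measurable g) (hL2 : MemLp g 2 μ)
    {n : ℕ} (hn : 0 < n) :
    ∫ ω, √(n : ℝ) * (sampleMean g (fun i : Fin n => ω i) - ∫ a, g a ∂μ) ^ 2
        ∂(Measure.infinitePi fun _ : ℕ => μ) = Var[g; μ] / √(n : ℝ) := by
  rw [integral_const_mul]
  have hv := variance_eq_integral (μ := Measure.infinitePi fun _ : ℕ => μ)
    (X := fun ω : ℕ → E => sampleMean g (fun i : Fin n => ω i))
    (measurable_sampleMean_run hg n).aemeasurable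
  rw [integral_sampleMean_run μ hg (hL2.integrable one_le_two) hn] at hv
  rw [← hv, variance_sampleMean_run μ hg hL2 hn]
  have hn' : (0 : ℝ) < n := by exact_mod_cast hn
  have hs : √(n : ℝ) ≠ 0 := (Real.sqrt_pos.2 hn').ne'
  rw [← mul_div_assoc, div_eq_div_iff hn'.ne' hs, mul_right_comm, Real.mul_self_sqrt hn'.le,
    mul_comm]

/-- **The quadratic remainder vanishes in probability**: for `g ∈ L²(μ)`, `√n (Ȳ_n − E_μ g)² → 0`
in measure along the run (it tends to `0` in `L¹`, its mean being `Var_μ[g]/√n`) — the step that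
lets a delta method for a smooth function of SEVERAL sample means run on the one-dimensional CLT. -/
theorem tendstoInMeasure_sqrt_mul_sq_sampleMean_sub {g : E → ℝ} (hg : Measurable g)
    (hL2 : MemLp g 2 μ) :
    TendstoInMeasure (Measure.infinitePi fun _ : ℕ => μ)
      (fun (n : ℕ) (ω : ℕ → E) => √(n : ℝ) * (sampleMean g (fun i : Fin n => ω i) - ∫ a, g a ∂μ) ^ 2)
      atTop (fun _ => 0) := by
  set P := Measure.infinitePi fun _ : ℕ => μ with hP
  have hmeas := fun n => measurable_sqrt_mul_sq_sampleMean_sub hg (∫ a, g a ∂μ) n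
  refine tendstoInMeasure_of_tendsto_eLpNorm one_ne_zero
    (fun n => (hmeas n).aestronglyMeasurable) aestronglyMeasurable_const ?_
  have hnn : ∀ (n : ℕ) (ω : ℕ → E),
      0 ≤ √(n : ℝ) * (sampleMean g (fun i : Fin n => ω i) - ∫ a, g a ∂μ) ^ 2 :=
    fun n ω => mul_nonneg (Real.sqrt_nonneg _) (sq_nonneg _)
  have hint : ∀ n : ℕ, Integrable
      (fun ω : ℕ → E => √(n : ℝ) * (sampleMean g (fun i : Fin n => ω i) - ∫ a, g a ∂μ) ^ 2) P :=
    fun n => ((memLp_sampleMean_run μ hg hL2 n).sub (memLp_const _)).integrable_sq.const_mul _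
  have heq : ∀ n : ℕ, eLpNorm ((fun ω : ℕ → E =>
      √(n : ℝ) * (sampleMean g (fun i : Fin n => ω i) - ∫ a, g a ∂μ) ^ 2) - fun _ => (0 : ℝ)) 1 P =
      ENNReal.ofReal (∫ ω, √(n : ℝ) * (sampleMean g (fun i : Fin n => ω i) - ∫ a, g a ∂μ) ^ 2 ∂P) := by
    intro n
    have hfun : ((fun ω : ℕ → E =>
        √(n : ℝ) * (sampleMean g (fun i : Fin n => ω i) - ∫ a, g a ∂μ) ^ 2) - fun _ => (0 : ℝ)) =
        fun ω => √(n : ℝ) * (sampleMean g (fun i : Fin n => ω i) - ∫ a, g a ∂μ) ^ 2 := by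
      funext ω; simp only [Pi.sub_apply, sub_zero]
    rw [hfun, eLpNorm_one_eq_lintegral_enorm,
      ofReal_integral_eq_lintegral_ofReal (hint n) (Eventually.of_forall (hnn n))]
    refine lintegral_congr fun ω => ?_
    exact Real.enorm_of_nonneg (hnn n ω)
  simp_rw [heq]
  rw [← ENNReal.ofReal_zero]
  refine ENNReal.tendsto_ofReal ?_
  have hlim : Tendsto (fun n : ℕ => Var[g; μ] / √(n : ℝ)) atTop (𝓝 0) := by
    simp_rw [div_eq_mul_inv]
    rw [← mul_zero (Var[g; μ])]
    exact Tendsto.const_mul _ (tendsto_inv_atTop_zero.comp <| Real.tendsto_sqrt_atTop.comp <|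
      tendsto_natCast_atTop_atTop)
  refine hlim.congr' ?_
  filter_upwards [eventually_gt_atTop 0] with n hn
  rw [hP, integral_sqrt_mul_sq_sampleMean_sub μ hg hL2 hn]

/-! ## The CLT for the Kish fraction -/

omit [MeasurableSpace E] in
/-- **The split.**  For `n ≥ 1`, a positive weight and `σ ≠ 0`:
`√n (essHat_n − θ²/σ) = (√n (S̄c_n − θ²σ) + σ · √n (Ȳ_n − θ)²) · S̄_n⁻¹ · σ⁻¹`, where `S̄c_n` is the
sample mean of the score `2θσ·w − θ²·w²` (so that `S̄c_n − θ²σ = 2θσ(Ȳ_n − θ) − θ²(S̄_n − σ)`). -/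
theorem sqrt_mul_essHat_sub_eq {w : E → ℝ} (hwpos : ∀ a, 0 < w a) {θ σ : ℝ} (hσ : σ ≠ 0)
    {n : ℕ} (hn : 0 < n) (y : Fin n → E) :
    √(n : ℝ) * (essHat (fun i => w (y i)) - θ ^ 2 / σ) =
      (√(n : ℝ) * (sampleMean (fun a => 2 * θ * σ * w a - θ ^ 2 * w a ^ 2) y - θ ^ 2 * σ) +
          σ * (√(n : ℝ) * (sampleMean w y - θ) ^ 2)) *
        (sampleMean (fun a => w a ^ 2) y)⁻¹ * σ⁻¹ := by
  have hn' : (n : ℝ) ≠ 0 := by exact_mod_cast hn.ne'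
  have hB : ∑ i, w (y i) ^ 2 ≠ 0 := by
    haveI : Nonempty (Fin n) := ⟨⟨0, hn⟩⟩
    exact (Finset.sum_pos (fun i _ => pow_pos (hwpos (y i)) 2) Finset.univ_nonempty).ne'
  simp only [essHat, sampleMean, Fintype.card_fin, Finset.sum_sub_distrib, ← Finset.mul_sum]
  field_simp
  ring

/-- **CLT for the Kish fraction (the two-dimensional delta method without a two-dimensional
CLT).**  For a positive measurable weight with `w² ∈ L²(μ)`, along an infinite i.i.d. run
`√n (essHat (w(ω i))_{i<n} − θ²/σ) →d N(0, Var_μ[2θσ·w − θ²·w²] / σ⁴)`, `θ = E_μ w`, `σ = E_μ w²`.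
Proof: the split `sqrt_mul_essHat_sub_eq`; the CLT for the sample mean of the score
(`tendstoInDistribution_sqrt_mul_sampleMean_sub`); the quadratic remainder `→ 0` in probability
(`tendstoInMeasure_sqrt_mul_sq_sampleMean_sub`) and `S̄_n⁻¹ → σ⁻¹` a.s.; Slutsky twice. -/
theorem tendstoInDistribution_sqrt_mul_essHat_sub {w : E → ℝ} (hwm : Measurable w)
    (hwpos : ∀ a, 0 < w a) (hL2sq : MemLp (fun a => w a ^ 2) 2 μ) {Y : Ω' → ℝ}
    (hY : HasLaw Y (gaussianReal 0
      (Var[fun a => 2 * (∫ a, w a ∂μ) * (∫ a, w a ^ 2 ∂μ) * w a - (∫ a, w a ∂μ) ^ 2 * w a ^ 2; μ] /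
        (∫ a, w a ^ 2 ∂μ) ^ 4).toNNReal) P') :
    TendstoInDistribution
      (fun (n : ℕ) (ω : ℕ → E) => √(n : ℝ) *
        (essHat (fun i : Fin n => w (ω i)) - (∫ a, w a ∂μ) ^ 2 / ∫ a, w a ^ 2 ∂μ))
      atTop Y (fun _ => Measure.infinitePi fun _ : ℕ => μ) P' := by
  set θ := ∫ a, w a ∂μ with hθdef
  set σ := ∫ a, w a ^ 2 ∂μ with hσdef
  set P := Measure.infinitePi fun _ : ℕ => μ with hP
  have hL2 : MemLp w 2 μ :=
    (memLp_two_iff_integrable_sq hwm.aestronglyMeasurable).2 (hL2sq.integrable one_le_two)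
  have hσ : 0 < σ := by
    have hsupp : Function.support (fun a => w a ^ 2) = univ := by
      ext a
      simp only [Function.mem_support, mem_univ, iff_true]
      exact (pow_pos (hwpos a) 2).ne'
    have hp := (integral_pos_iff_support_of_nonneg (μ := μ) (f := fun a => w a ^ 2)
      (fun a => sq_nonneg (w a)) hL2.integrable_sq).2 (by rw [hsupp, measure_univ]; exact one_pos)
    rw [hσdef]
    exact hp
  -- the score and its CLT, against `Y₀ = σ²·Y ~ N(0, Var sc)`
  set sc : E → ℝ := fun a => 2 * θ * σ * w a - θ ^ 2 * w a ^ 2 with hsc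
  have hscm : Measurable sc := (hwm.const_mul _).sub ((hwm.pow_const 2).const_mul _)
  have hw1 : MemLp (fun a => 2 * θ * σ * w a) 2 μ := hL2.const_mul _
  have hw2 : MemLp (fun a => θ ^ 2 * w a ^ 2) 2 μ := hL2sq.const_mul _
  have hscL2 : MemLp sc 2 μ := hw1.sub hw2
  have hmean : ∫ a, sc a ∂μ = θ ^ 2 * σ := by
    have hi1 : Integrable (fun a => 2 * θ * σ * w a) μ := hw1.integrable one_le_two
    have hi2 : Integrable (fun a => θ ^ 2 * w a ^ 2) μ := hw2.integrable one_le_two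
    simp only [hsc]
    rw [integral_sub hi1 hi2, integral_const_mul, integral_const_mul, ← hθdef, ← hσdef]
    ring
  have hY' : HasLaw Y (gaussianReal 0 (Var[sc; μ] / (σ ^ 2) ^ 2).toNNReal) P' := by
    rw [show (σ ^ 2) ^ 2 = σ ^ 4 by ring]
    exact hY
  have hY₀ := hasLaw_const_mul_gaussianReal (variance_nonneg sc μ) (pow_ne_zero 2 hσ.ne')
    (c := σ ^ 2) rfl hY'
  have clt := tendstoInDistribution_sqrt_mul_sampleMean_sub μ hscm hscL2 hY₀
  rw [hmean] at clt
  -- Slutsky I: add the quadratic remainder `σ · √n (Ȳ_n − θ)² → 0`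
  have hR := tendstoInMeasure_sqrt_mul_sq_sampleMean_sub μ hwm hL2
  have hRmeas : ∀ n : ℕ, AEMeasurable
      (fun ω : ℕ → E => √(n : ℝ) * (sampleMean w (fun i : Fin n => ω i) - θ) ^ 2) P :=
    fun n => (measurable_sqrt_mul_sq_sampleMean_sub hwm θ n).aemeasurable
  have slutsky1 := clt.continuous_comp_prodMk_of_tendstoInMeasure_const
    (g := fun p : ℝ × ℝ => p.1 + σ * p.2) (by fun_prop) hR hRmeas
  -- Slutsky II: multiply by `S̄_n⁻¹ → σ⁻¹` (and by the constant `σ⁻¹`)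
  have hUmeas : ∀ n : ℕ, AEMeasurable
      (fun ω : ℕ → E => (sampleMean (fun a => w a ^ 2) (fun i : Fin n => ω i))⁻¹) P :=
    fun n => ((measurable_sampleMean_run (hwm.pow_const 2) n).inv).aemeasurable
  have hU : TendstoInMeasure P
      (fun (n : ℕ) (ω : ℕ → E) => (sampleMean (fun a => w a ^ 2) (fun i : Fin n => ω i))⁻¹)
      atTop (fun _ => σ⁻¹) := by
    refine tendstoInMeasure_of_tendsto_ae (fun n => (hUmeas n).aestronglyMeasurable) ?_
    filter_upwards [tendsto_sampleMean_ae μ (hwm.pow_const 2) hL2.integrable_sq] with ω hω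
    exact hω.inv₀ hσ.ne'
  have slutsky2 := slutsky1.continuous_comp_prodMk_of_tendstoInMeasure_const
    (g := fun p : ℝ × ℝ => p.1 * p.2 * σ⁻¹) (by fun_prop) hU hUmeas
  refine slutsky2.congr (fun n => Eventually.of_forall fun ω => ?_)
    (Eventually.of_forall fun ω' => ?_)
  · -- the split, pointwise
    simp only
    rcases Nat.eq_zero_or_pos n with rfl | hn
    · simp [essHat, sampleMean]
    · exact (sqrt_mul_essHat_sub_eq hwpos hσ.ne' hn (fun i : Fin n => ω i)).symm
  · show (σ ^ 2 * Y ω' + σ * 0) * σ⁻¹ * σ⁻¹ = Y ω'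
    rw [mul_zero, add_zero, mul_comm (σ ^ 2) (Y ω'), mul_assoc, ← mul_inv, ← sq,
      mul_inv_cancel_right₀ (pow_ne_zero 2 hσ.ne')]

end IID

/-! ## For a Crooks pair: the reported `ess` fraction is asymptotically normal around `ESS_F` -/

namespace CrooksPair

variable {Ω : Type*} [MeasurableSpace Ω]
variable {ν₀ ν₁ : Measure Ω} {κF κR : Kernel Ω E} {s e : E → Ω} {W : E → ℝ}
variable {Ω' : Type*} [MeasurableSpace Ω'] {P' : Measure Ω'} [IsProbabilityMeasure P']

/-- **CLT for the Kish fraction of a Crooks pair.**  For every Crooks pair on a general measurable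
state space with `e^{−2W} ∈ L²(P_F)` (i.e. `E_F e^{−4W} < ∞`), along an infinite run of
independent forward evolutions from prior equilibrium,
`√n (essHat (e^{−W_i})_{i<n} − ESS_F) →d N(0, Var_F[2θσ·e^{−W} − θ²·e^{−2W}] / σ⁴)` with
`θ = Z₁/Z₀ = e^{−ΔF}` (Jarzynski), `σ = E_F e^{−2W}` and `ESS_F = θ²/σ` the population Kish
fraction of `NCMCGeneralSpaceDissipation.lean`. -/
theorem tendstoInDistribution_essHat [IsFiniteMeasure ν₀] [IsMarkovKernel κF] [IsMarkovKernel κR]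
    (h0 : ν₀ univ ≠ 0) (h : CrooksPair ν₀ ν₁ κF κR s e W)
    (hL2sq : MemLp (fun ε => Real.exp (-(2 * W ε))) 2 (fwdPathLaw ν₀ κF)) {Y : Ω' → ℝ}
    (hY : HasLaw Y (gaussianReal 0
      (Var[fun ε => 2 * ((ν₀ univ)⁻¹ * ν₁ univ).toReal *
          (∫ ε, Real.exp (-(2 * W ε)) ∂(fwdPathLaw ν₀ κF)) * Real.exp (-W ε) -
          ((ν₀ univ)⁻¹ * ν₁ univ).toReal ^ 2 * Real.exp (-(2 * W ε)); fwdPathLaw ν₀ κF] /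
        (∫ ε, Real.exp (-(2 * W ε)) ∂(fwdPathLaw ν₀ κF)) ^ 4).toNNReal) P') :
    haveI := isProbabilityMeasure_fwdPathLaw ν₀ h0 κF
    TendstoInDistribution
      (fun (n : ℕ) (ω : ℕ → E) => √(n : ℝ) *
        (essHat (fun i : Fin n => Real.exp (-W (ω i))) -
          (∫ ε, Real.exp (-W ε) ∂(fwdPathLaw ν₀ κF)) ^ 2 /
            ∫ ε, Real.exp (-(2 * W ε)) ∂(fwdPathLaw ν₀ κF)))
      atTop Y (fun _ => Measure.infinitePi fun _ : ℕ => fwdPathLaw ν₀ κF) P' := by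
  haveI := isProbabilityMeasure_fwdPathLaw ν₀ h0 κF
  have hsq : ∀ ε, Real.exp (-W ε) ^ 2 = Real.exp (-(2 * W ε)) := fun ε => by
    rw [sq, ← Real.exp_add]; congr 1; ring
  have hL2sq' : MemLp (fun ε => Real.exp (-W ε) ^ 2) 2 (fwdPathLaw ν₀ κF) :=
    hL2sq.ae_eq (Eventually.of_forall fun ε => (hsq ε).symm)
  have key := tendstoInDistribution_sqrt_mul_essHat_sub (fwdPathLaw ν₀ κF)
    (w := fun ε => Real.exp (-W ε)) (Real.measurable_exp.comp h.measurable_W.neg)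
    (fun ε => Real.exp_pos _) hL2sq' (Y := Y) (P' := P') (by
      simp only [hsq]
      rw [h.integral_exp_neg_work]
      exact hY)
  simpa only [hsq] using key

/-- **The asymptotic variance in dissipation form.**  With `e^{−ΔF} = Z₁/Z₀`, `W_d = W − ΔF` and
`m₂ = E_F e^{−2W_d} = 1/ESS_F` (`NCMCGeneralSpaceDissipation.essPop_eq_inv_dissipation`):
`Var_F[2θσ e^{−W} − θ² e^{−2W}]/σ⁴ = ESS_F² · Var_F[2e^{−W_d} − ESS_F·e^{−2W_d}]` — the score is
`θ⁴ m₂ · (2e^{−W_d} − ESS_F e^{−2W_d})` and `σ = θ² m₂`.  So the `N^{−1/2}`-fluctuation of the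
reported `ess/N` is governed by the first FOUR exponential moments of the dissipated work. -/
theorem essHat_asymptoticVariance_eq [IsFiniteMeasure ν₀] [IsFiniteMeasure ν₁] [IsMarkovKernel κF]
    (h0 : ν₀ univ ≠ 0) (h1 : ν₁ univ ≠ 0) {ΔF : ℝ}
    (hΔF : Real.exp (-ΔF) = ((ν₀ univ)⁻¹ * ν₁ univ).toReal)
    (hint : Integrable (fun ε => Real.exp (-(2 * W ε))) (fwdPathLaw ν₀ κF)) :
    Var[fun ε => 2 * ((ν₀ univ)⁻¹ * ν₁ univ).toReal *
          (∫ ε, Real.exp (-(2 * W ε)) ∂(fwdPathLaw ν₀ κF)) * Real.exp (-W ε) -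
          ((ν₀ univ)⁻¹ * ν₁ univ).toReal ^ 2 * Real.exp (-(2 * W ε)); fwdPathLaw ν₀ κF] /
        (∫ ε, Real.exp (-(2 * W ε)) ∂(fwdPathLaw ν₀ κF)) ^ 4 =
      (1 / ∫ ε, Real.exp (-(2 * (W ε - ΔF))) ∂(fwdPathLaw ν₀ κF)) ^ 2 *
        Var[fun ε => 2 * Real.exp (-(W ε - ΔF)) -
          (1 / ∫ ε, Real.exp (-(2 * (W ε - ΔF))) ∂(fwdPathLaw ν₀ κF)) * Real.exp (-(2 * (W ε - ΔF)));
          fwdPathLaw ν₀ κF] := by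
  haveI := isProbabilityMeasure_fwdPathLaw ν₀ h0 κF
  set P := fwdPathLaw ν₀ κF with hP
  set θ := ((ν₀ univ)⁻¹ * ν₁ univ).toReal with hθdef
  set m₂ := ∫ ε, Real.exp (-(2 * (W ε - ΔF))) ∂P with hm₂
  have hθpos : 0 < θ := toReal_ratio_pos h0 h1
  have hpt2 : ∀ ε, Real.exp (-(2 * W ε)) = θ ^ 2 * Real.exp (-(2 * (W ε - ΔF))) := fun ε => by
    rw [← hΔF, sq, ← Real.exp_add, ← Real.exp_add]; congr 1; ring
  have hpt1 : ∀ ε, Real.exp (-W ε) = θ * Real.exp (-(W ε - ΔF)) := fun ε => by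
    rw [← hΔF, ← Real.exp_add]; congr 1; ring
  have hσ : ∫ ε, Real.exp (-(2 * W ε)) ∂P = θ ^ 2 * m₂ := by
    rw [hm₂, ← integral_const_mul]
    exact integral_congr_ae (Eventually.of_forall hpt2)
  have hint' : Integrable (fun ε => Real.exp (-(2 * (W ε - ΔF)))) P := by
    refine (hint.const_mul (θ ^ 2)⁻¹).congr (Eventually.of_forall fun ε => ?_)
    simp only [hpt2 ε]
    rw [← mul_assoc, inv_mul_cancel₀ (pow_ne_zero 2 hθpos.ne'), one_mul]
  have hm₂ne : m₂ ≠ 0 := (integral_exp_pos hint').ne'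
  have hfun : (fun ε => 2 * θ * (∫ ε, Real.exp (-(2 * W ε)) ∂P) * Real.exp (-W ε) -
      θ ^ 2 * Real.exp (-(2 * W ε))) = fun ε => (θ ^ 4 * m₂) *
      (2 * Real.exp (-(W ε - ΔF)) - (1 / m₂) * Real.exp (-(2 * (W ε - ΔF)))) := by
    funext ε
    rw [hσ, hpt1 ε, hpt2 ε]
    field_simp
  rw [hfun, variance_const_mul, hσ]
  field_simp

/-- **CLT for the Kish fraction, dissipation form**: for every Crooks pair with
`E_F e^{−4W} < ∞` and `e^{−ΔF} = Z₁/Z₀`, along independent forward evolutions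
`√n (essHat (e^{−W_i})_{i<n} − ESS_F) →d N(0, ESS_F² · Var_F[2e^{−W_d} − ESS_F·e^{−2W_d}])`,
`W_d = W − ΔF`, `ESS_F = 1/E_F e^{−2W_d}`. -/
theorem tendstoInDistribution_essHat_dissipation [IsFiniteMeasure ν₀] [IsFiniteMeasure ν₁]
    [IsMarkovKernel κF] [IsMarkovKernel κR] (h0 : ν₀ univ ≠ 0) (h1 : ν₁ univ ≠ 0)
    (h : CrooksPair ν₀ ν₁ κF κR s e W)
    (hL2sq : MemLp (fun ε => Real.exp (-(2 * W ε))) 2 (fwdPathLaw ν₀ κF)) {ΔF : ℝ}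
    (hΔF : Real.exp (-ΔF) = ((ν₀ univ)⁻¹ * ν₁ univ).toReal) {Y : Ω' → ℝ}
    (hY : HasLaw Y (gaussianReal 0
      ((1 / ∫ ε, Real.exp (-(2 * (W ε - ΔF))) ∂(fwdPathLaw ν₀ κF)) ^ 2 *
        Var[fun ε => 2 * Real.exp (-(W ε - ΔF)) -
          (1 / ∫ ε, Real.exp (-(2 * (W ε - ΔF))) ∂(fwdPathLaw ν₀ κF)) * Real.exp (-(2 * (W ε - ΔF)));
          fwdPathLaw ν₀ κF]).toNNReal) P') :
    haveI := isProbabilityMeasure_fwdPathLaw ν₀ h0 κF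
    TendstoInDistribution
      (fun (n : ℕ) (ω : ℕ → E) => √(n : ℝ) *
        (essHat (fun i : Fin n => Real.exp (-W (ω i))) -
          1 / ∫ ε, Real.exp (-(2 * (W ε - ΔF))) ∂(fwdPathLaw ν₀ κF)))
      atTop Y (fun _ => Measure.infinitePi fun _ : ℕ => fwdPathLaw ν₀ κF) P' := by
  haveI := isProbabilityMeasure_fwdPathLaw ν₀ h0 κF
  rw [← essHat_asymptoticVariance_eq h0 h1 hΔF (hL2sq.integrable one_le_two)] at hY
  rw [← h.essPop_eq_inv_dissipation h0 h1 hΔF]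
  exact h.tendstoInDistribution_essHat h0 hL2sq hY

end CrooksPair

end Summit.Ventures.LatticeQCDFlow.Exactness.GeneralNCMC
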